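import Summits.Ventures.HSemireg.Pad4TowerRuleDMu4
import Summits.Ventures.HSemireg.Pad4TowerXPhaseMu4Unit

/-!
# Venture HSemireg — PAD-4 on 𝔅(μ₄): the alphabet `𝒰` (all four phases), its move table, and the scope predicates of
# THEOREM X∞ on `Pad4TowerCrossPhase.MConfig`

HONEST FRAMING. Lean index of the computation cell `pub-hsemireg` (S4-PUSH, H2 door PAD-4); seat `hodge-semireg-assembly-p1`
(g1; W2 «assembly from typed lemmas», director-hodge g10 cell INBOX l.31377: «the μ₄ LIFT of THEOREM X∞ as ONE kernel theorem on
`Pad4TowerCrossPhase.MConfig` from typed lemmas … state XClean exactly as g0's `xPhaseDeadMu4_of_ray` hypothesis pattern»). All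
earlier W2 files of this seat (`Pad4TowerXInfA∕B`, `Pad4TowerXInf`) are on the (F1ℝ) SLICE (phases `±1`). This is the first of four
files (`Pad4TowerAlphabetMu4` → `Pad4TowerXInfMu4A`, `Pad4TowerFrameLift` → `Pad4TowerXInfMu4`) proving THEOREM X∞ of bc5-plan g4's
memo v4.1 ON 𝔅(μ₄) ITSELF, all four phases, in typer-2's μ₄ vocabulary (`MCell`, `MConfig`, `UPartner`, `lpt`, `ray` of
`Pad4TowerCrossPhase`; `RuleDMu4Closed` and its engine of `Pad4TowerRuleDMu4`; `XPhaseDeadMu4`).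

CONTENT (definitions are the memo's words; theorems are bookkeeping). §1 **`InUMu4`** = the universe `𝒰` of memo (0.1) on
`BPoint`s: `O`, pure rays `c·ℓ_u = lpt c k`, simple towers `T_{c,u} = 2I + c·ℓ_u = towPt c k = ray (2,0,0) k c`, `c ≥ 1`,
`u = i^k ∈ μ₄` — written on components (decidable), with the word form `inUMu4_iff`; cone ∕ level facts feeding typer-2's engine
(`InUMu4.effective`, `.levelLeTwo`, `.linf`, `.axis`); frame data of rays and towers (`frame_lpt`, `frame_towPt`: adapted to the
own frame `{k, k+2}`, coordinates `(2c, 0)` ∕ `(2c+2, 2)`); the MOVE TABLE of memo (0.2) inside `𝒰`, all phases: `below_lpt`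
(«from a ray DOWN: own direction only»), `below_towPt` («from a tower DOWN: own … or antipodal to (c+1)·ℓ_u, d = 1 only»);
`rotPt` (phase rotation `β ↦ i^j β`, `rotPt_lpt`). §2 the SCOPE PREDICATES of memo (0.5) on `MConfig`: **`PSCMu4`** ((S-iii):
every phase rotation of every factor of an O-carrying `N`-cell is an `N`-cell), **`XCleanMu4`** ((S-ii) with (0.4): the bracket is
VERBATIM the hypothesis list of `Pad4TowerXPhaseMu4Unit.xPhaseDeadMu4_of_ray`, whence `xcleanMu4_of_immune`: X-PHASE-immune ⇒
X-clean), `MixedMu4` (memo §2's `𝒩_c ∪ 𝒫_c`), **`AdmissibleMu4`** (letters in `𝒰`, `RuleDMu4Closed`, PSC, X-clean), `FCMu4`.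

WHAT IS NOT HERE ∕ NOT IN LEAN. The (E1)∕(H2) meaning of RULE D (PAIR-IMAGE THEOREM, PAD4-BALANCED §1′) and of the X-clean bracket
(LEMMA X-PHASE §22) — pencil of the cell, cited in typer-2's files; multiplicities, sections, modes; (F2)∕Pythagorean letters. Nothing
is a statement about a variety, a sheaf, `σ`, a seed or an abelian variety; NOTHING HERE SAYS THAT HC ∕ HC_CM ∕ HC_AV ∕ W₆ ∕
HC_Kum4Type HOLDS OR FAILS. No `instance`, no notation, no named fact, 0 `sorry`; axioms standard.

SOURCES (sha16): BC5-PLAN-g4-MEMO.md v4.1 df3e4f41db3c2fcf §0 (0.1)–(0.5), §6 typed sentence «in the (F1ℝ) slice: u ∈ {±1}» ∕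
«the μ₄ statement is the same with four null directions per factor» (§0–§6 byte-identical in v4.8 97cc7726c3e53c00);
`Pad4TowerRuleDMu4.lean` 7f3a78a9d76f5e0c (p551028), `Pad4TowerCrossPhase.lean` 8f09792281b0723a (p540496),
`Pad4TowerXPhaseMu4Unit.lean` cc1e0c8a79c27d56 (p546799: `lpt_eq`, `eq_lpt_of_ray`, `effective_lpt∕tower`, `xPhaseDeadMu4_of_ray`),
`Pad4TowerXInfA.lean` 69fd0bbeca40d0fc (the (F1ℝ) `InUscr ∕ PSC ∕ XClean ∕ Mixed` these predicates lift).
-/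

namespace Summit.Ventures.HSemireg.Pad4Tower

open Finset

/-! ## §1 The alphabet 𝒰 on 𝔅(μ₄): `O`, pure rays `c·ℓ_u`, simple towers `2I + c·ℓ_u` (`c ≥ 1`, `u ∈ μ₄`) -/

/-- the simple tower `T_{c,u} = 2I + c·ℓ_u` (`u = i^k`) as a factor point: `(c + 2, c·conj(i^k))` (memo (0.1): light-cone
coordinates `(c+1, 1)_u`; `Pad4TowerRuleDMu4` writes it `ray (2,0,0) k c`). -/
abbrev towPt (c : ℤ) (k : Fin 4) : BPoint := ray (2, 0, 0) k c

/-- **the universe `𝒰` on 𝔅(μ₄)** (bc5-plan g4 memo v4.1 (0.1): «𝒰 := {O} ∪ {pure rays c·ℓ_u : c ≥ 1} ∪ {simple towers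
T_{c,u} = 2I + c·ℓ_u : c ≥ 1}, u ∈ μ₄, c UNBOUNDED … relative level t := α − |β| ∈ {0, 2}, no bare node»). Written on the
components so that it is decidable (the charge of a ray is `α`, of a tower `α − 2`). -/
abbrev InUMu4 (x : BPoint) : Prop :=
  x = (0, 0, 0) ∨ ∃ k : Fin 4, (1 ≤ x.1 ∧ x = lpt x.1 k) ∨ (3 ≤ x.1 ∧ x = towPt (x.1 - 2) k)

/-- components of a tower point. -/
theorem towPt_eq (c : ℤ) (k : Fin 4) : towPt c k = (c + 2, c * ![1, 0, -1, 0] k, c * ![0, -1, 0, 1] k) := by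
  fin_cases k <;> simp <;> ring

/-- `𝒰` in words: `O`, a ray `c·ℓ_{i^k}` or a tower `2I + c·ℓ_{i^k}` with `c ≥ 1`. -/
theorem inUMu4_iff (x : BPoint) :
    InUMu4 x ↔ x = (0, 0, 0) ∨ ∃ k : Fin 4, ∃ c : ℤ, 1 ≤ c ∧ (x = lpt c k ∨ x = towPt c k) := by
  constructor
  · rintro (h | ⟨k, ⟨h1, h⟩ | ⟨h3, h⟩⟩)
    · exact Or.inl h
    · exact Or.inr ⟨k, x.1, h1, Or.inl h⟩
    · exact Or.inr ⟨k, x.1 - 2, by omega, Or.inr h⟩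
  · rintro (h | ⟨k, c, hc, h | h⟩)
    · exact Or.inl h
    · have : x.1 = c := by rw [h, lpt_eq]
      exact Or.inr ⟨k, Or.inl ⟨by omega, by rw [this]; exact h⟩⟩
    · have : x.1 = c + 2 := by rw [h, towPt_eq]
      exact Or.inr ⟨k, Or.inr ⟨by omega, by rw [this, add_sub_cancel_right]; exact h⟩⟩

/-- `lpt 0 k = O`. -/
theorem lpt_zero (k : Fin 4) : lpt 0 k = (0, 0, 0) := by
  rw [lpt_eq]; simp

/-- rays of non-negative charge lie in `𝒰`. -/
theorem inUMu4_lpt {c : ℤ} (hc : 0 ≤ c) (k : Fin 4) : InUMu4 (lpt c k) := by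
  rcases (show c = 0 ∨ 1 ≤ c by omega) with rfl | h1
  · exact Or.inl (lpt_zero k)
  · exact (inUMu4_iff _).2 (Or.inr ⟨k, c, h1, Or.inl rfl⟩)

/-- towers of positive charge lie in `𝒰`. -/
theorem inUMu4_towPt {c : ℤ} (hc : 1 ≤ c) (k : Fin 4) : InUMu4 (towPt c k) :=
  (inUMu4_iff _).2 (Or.inr ⟨k, c, hc, Or.inr rfl⟩)

/-- every letter of `𝒰` lies in the closed future cone of `O` (the cone hypothesis of `Pad4TowerRuleDMu4`'s engine and of
`Pad4TowerXPhaseMu4Unit`'s kills). -/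
theorem InUMu4.effective {x : BPoint} (hx : InUMu4 x) : Effective x := by
  rcases (inUMu4_iff x).1 hx with rfl | ⟨k, c, hc, rfl | rfl⟩
  · decide
  · exact effective_lpt (by omega) k
  · exact effective_tower (by omega) k

/-- every letter of `𝒰` has relative level `≤ 2` (the hypothesis of `Pad4TowerRuleDMu4.settledAbove_of_tower`). -/
theorem InUMu4.levelLeTwo {x : BPoint} (hx : InUMu4 x) : LevelLeTwo x := by
  rcases (inUMu4_iff x).1 hx with rfl | ⟨k, c, hc, rfl | rfl⟩
  · exact Or.inl ⟨rfl, Or.inl (by decide)⟩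
  · fin_cases k <;> simp [lpt_eq, LevelLeTwo]
  · fin_cases k <;> simp [LevelLeTwo] <;> omega

/-- a letter of `𝒰` has non-negative height `α`. -/
theorem InUMu4.fst_nonneg {x : BPoint} (hx : InUMu4 x) : 0 ≤ x.1 := hx.effective.1

/-- the apex is adapted to every direction … -/
theorem adapted_O (k : Fin 4) : Adapted ((0, 0, 0) : BPoint) k := by
  fin_cases k <;> simp [Adapted]

/-- … with all four coordinates `0`. -/
theorem coord_O (k : Fin 4) : coord ((0, 0, 0) : BPoint) k = 0 := by
  fin_cases k <;> simp [coord]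

/-- frame data of a pure ray `c·ℓ_{i^k}`: adapted to its own frame `{k, k+2}`, own coordinate `2c`, antipodal coordinate `0`. -/
theorem frame_lpt (c : ℤ) (k : Fin 4) :
    Adapted (lpt c k) k ∧ Adapted (lpt c k) (k + 2) ∧ coord (lpt c k) k = 2 * c ∧ coord (lpt c k) (k + 2) = 0 := by
  fin_cases k <;> simp [lpt_eq, Adapted, coord] <;> ring

/-- frame data of a tower `2I + c·ℓ_{i^k}`: adapted to `{k, k+2}`, own coordinate `2c + 2`, antipodal coordinate `2`. -/
theorem frame_towPt (c : ℤ) (k : Fin 4) :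
    Adapted (towPt c k) k ∧ Adapted (towPt c k) (k + 2) ∧ coord (towPt c k) k = 2 * c + 2 ∧
      coord (towPt c k) (k + 2) = 2 := by
  fin_cases k <;> simp [Adapted, coord] <;> ring

/-- a CHARGED letter of `𝒰` has an adapted coordinate `≠ 0` … -/
theorem InUMu4.exists_coord_ne_zero {x : BPoint} (hx : InUMu4 x) (h0 : x ≠ (0, 0, 0)) :
    ∃ k, Adapted x k ∧ coord x k ≠ 0 := by
  rcases (inUMu4_iff x).1 hx with rfl | ⟨k, c, hc, rfl | rfl⟩
  · exact absurd rfl h0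
  · exact ⟨k, (frame_lpt c k).1, by rw [(frame_lpt c k).2.2.1]; omega⟩
  · exact ⟨k, (frame_towPt c k).1, by rw [(frame_towPt c k).2.2.1]; omega⟩

/-- … and two DIFFERENT adapted coordinates (rays `(c, 0)`, towers `(c+1, 1)`: `𝒰` has no bare node). -/
theorem InUMu4.exists_coords_ne {x : BPoint} (hx : InUMu4 x) (h0 : x ≠ (0, 0, 0)) :
    ∃ k, Adapted x k ∧ Adapted x (k + 2) ∧ coord x k ≠ coord x (k + 2) := by
  rcases (inUMu4_iff x).1 hx with rfl | ⟨k, c, hc, rfl | rfl⟩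
  · exact absurd rfl h0
  · obtain ⟨h1, h2, h3, h4⟩ := frame_lpt c k
    exact ⟨k, h1, h2, by rw [h3, h4]; omega⟩
  · obtain ⟨h1, h2, h3, h4⟩ := frame_towPt c k
    exact ⟨k, h1, h2, by rw [h3, h4]; omega⟩

/-- a point raised by `e ≥ 1` null steps from a point of non-negative height is not the apex. -/
theorem ray_ne_O {y : BPoint} (hy : 0 ≤ y.1) (r : Fin 4) {e : ℤ} (he : 1 ≤ e) : ray y r e ≠ (0, 0, 0) := by
  intro h
  have := congrArg (fun p : BPoint => p.1) h
  simp only at this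
  omega

/-- **BELOW A RAY, inside `𝒰`: own direction only** (memo (0.2) «from a ray (c,0)_u DOWN: own direction u only, to (c−d, 0)»):
a `𝒰`-letter `y` strictly below `c·ℓ_{i^k}` along a null direction `r` has `r = k` and is the own ray `y = (y.α)·ℓ_{i^k}`. -/
theorem below_lpt {c : ℤ} (hc : 1 ≤ c) {k r : Fin 4} {y : BPoint} (hy : InUMu4 y) (hlt : y.1 < (lpt c k).1)
    (h : lpt c k = ray y r ((lpt c k).1 - y.1)) : r = k ∧ y = lpt y.1 k ∧ 0 ≤ y.1 := by
  obtain rfl := dir_eq_of_below_ray hc hy.effective hlt h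
  have hy' := eq_lpt_of_ray h
  have hc1 : (lpt c r).1 = c := by rw [lpt_eq]
  rw [hc1, sub_sub_cancel] at hy'
  exact ⟨rfl, hy', hy.fst_nonneg⟩

/-- **BELOW A TOWER, inside `𝒰`** (memo (0.2) «from a tower (c+1,1)_u DOWN: own to T_{c−d,u} (1 ≤ d ≤ c−1) or to ℓ_{−u}
(d = c+1) [d = c gives the bare node, absent], antipodal to (c+1)·ℓ_u (d = 1 only)»): a `𝒰`-letter `y` strictly below the tower
`2I + c·ℓ_{i^k}` along the direction `r` is, if `r ≠ k`, the antipodal step `r = k + 2` down to the pure ray `(c+1)·ℓ_{i^k}`. -/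
theorem below_towPt {c : ℤ} (hc : 1 ≤ c) {k r : Fin 4} {y : BPoint} (hy : InUMu4 y) (hlt : y.1 < (towPt c k).1)
    (h : towPt c k = ray y r ((towPt c k).1 - y.1)) (hrk : r ≠ k) : r = k + 2 ∧ y = lpt (c + 1) k := by
  obtain ⟨a, b₁, b₂⟩ := y
  rw [towPt_eq] at h hlt
  simp only at hlt
  have h1 := congrArg (fun p : BPoint => p.2.1) h
  have h2 := congrArg (fun p : BPoint => p.2.2) h
  simp only at h1 h2
  rcases (inUMu4_iff _).1 hy with h0 | ⟨k', c', hc', hy' | hy'⟩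
  · simp only [Prod.mk.injEq] at h0
    obtain ⟨rfl, rfl, rfl⟩ := h0
    fin_cases k <;> fin_cases r <;> simp at h1 h2 hrk ⊢ <;> omega
  · rw [lpt_eq] at hy'
    simp only [Prod.mk.injEq] at hy'
    obtain ⟨rfl, rfl, rfl⟩ := hy'
    refine ⟨?_, ?_⟩
    · fin_cases k <;> fin_cases r <;> fin_cases k' <;> simp at h1 h2 hrk ⊢ <;> omega
    · rw [lpt_eq]
      fin_cases k <;> fin_cases r <;> fin_cases k' <;> simp at h1 h2 hrk ⊢ <;> omega
  · rw [towPt_eq] at hy'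
    simp only [Prod.mk.injEq] at hy'
    obtain ⟨rfl, rfl, rfl⟩ := hy'
    exfalso
    fin_cases k <;> fin_cases r <;> fin_cases k' <;> simp at h1 h2 hrk ⊢ <;> omega

/-- the PHASE ROTATION of a factor point by `i^j`: `(α, β) ↦ (α, i^j·β)`. -/
def rotPt (x : BPoint) (j : Fin 4) : BPoint :=
  (x.1, ![x.2.1, -x.2.2, -x.2.1, x.2.2] j, ![x.2.2, x.2.1, -x.2.2, -x.2.1] j)

/-- rotating the ray `c·ℓ_{i^k}` by `i^j` gives the ray `c·ℓ_{i^{k−j}}` (`ℓ_u` has `β = c·ū`). -/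
theorem rotPt_lpt (c : ℤ) (k j : Fin 4) : rotPt (lpt c k) j = lpt c (k - j) := by
  fin_cases k <;> fin_cases j <;> simp [rotPt, lpt_eq]

/-- a point strictly above a point of non-negative height is not the apex. -/
theorem ne_O_of_lt {x y : BPoint} (hx : 0 ≤ x.1) (h : x.1 < y.1) : y ≠ (0, 0, 0) := by
  intro h0
  rw [h0] at h
  simp only at h
  omega

/-- a ray of positive charge is not the apex. -/
theorem lpt_ne_O {c : ℤ} (hc : 1 ≤ c) (k : Fin 4) : lpt c k ≠ (0, 0, 0) := by
  rw [lpt_eq]; intro h; have := congrArg (fun p : BPoint => p.1) h; simp only at this; omega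

/-- the `ℓ^∞` shadow of effectiveness for `𝒰`-letters: `|Re β|, |Im β| ≤ α`. -/
theorem InUMu4.linf {y : BPoint} (hy : InUMu4 y) : y.2.1 ≤ y.1 ∧ -y.2.1 ≤ y.1 ∧ y.2.2 ≤ y.1 ∧ -y.2.2 ≤ y.1 := by
  rcases (inUMu4_iff _).1 hy with rfl | ⟨k, c, hc, rfl | rfl⟩
  · decide
  · fin_cases k <;> simp [lpt_eq] <;> omega
  · fin_cases k <;> simp <;> omega

/-- `𝒰`-letters are μ₄-phased: `β` lies on an axis. -/
theorem InUMu4.axis {y : BPoint} (hy : InUMu4 y) : y.2.1 = 0 ∨ y.2.2 = 0 := by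
  rcases (inUMu4_iff _).1 hy with rfl | ⟨k, c, hc, rfl | rfl⟩
  · exact Or.inl rfl
  · fin_cases k <;> simp [lpt_eq]
  · fin_cases k <;> simp

/-! ## §2 The scope predicates of THEOREM X∞ on 𝔅(μ₄) (bc5-plan g4 memo v4.1 (0.4)–(0.5), all four phases) -/

/-- **PSC on 𝔅(μ₄)** — phase-sibling closure (memo (0.5) (S-iii): «for every N-class Z ∈ S that has an O-factor, every factor σ
carrying a charged letter of phase u, and every w ∈ μ₄, the class Z[σ: phase u ↦ w] ∈ S»; every G-invariant support is PSC):
at an `N`-cell with an O-factor, every phase rotation of every factor stays an `N`-cell (rotating `O` does nothing). -/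
abbrev PSCMu4 (C : MConfig) : Prop :=
  ∀ Z ∈ C.lower, (∃ f, Z f = (0, 0, 0)) → ∀ σ j, Function.update Z σ (rotPt (Z σ) j) ∈ C.lower

/-- **X-CLEAN on 𝔅(μ₄)** (memo (0.5) (S-ii) with (0.4) = LEMMA X-PHASE §22 REMARK (2), the apex-vertex instance at general
depth): NO `N`-cell `Z` has an O-factor `f`, a pure ray `c·ℓ_u` on `σ ≠ f` with (x1) its full cancellation `Z[σ ↦ O]` a `P`-cell
and no intermediate own-ray `P`-cell `Z[σ ↦ c′ℓ_u]`, (x2) a sibling `Z[σ ↦ c·ℓ_w]` (`w ≠ u`) an `N`-cell, (x3) no `w`-companion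
`P`-cell `Z[σ ↦ c′ℓ_w]` (`1 ≤ c′ < c`). The bracket is VERBATIM the hypothesis list of
`Pad4TowerXPhaseMu4Unit.xPhaseDeadMu4_of_ray`, so a configuration none of whose `N`-cells is `XPhaseDeadMu4` is X-clean
(`xcleanMu4_of_immune`). Pencil meaning of the bracket (NOT in Lean): `Z` violates (E1). -/
abbrev XCleanMu4 (C : MConfig) : Prop :=
  ∀ Z ∈ C.lower, ∀ f σ : Fin 4, σ ≠ f → Z f = (0, 0, 0) → ∀ (k : Fin 4) (c : ℤ), 1 ≤ c → Z σ = lpt c k →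
    ¬ (Function.update Z σ (0, 0, 0) ∈ C.upper ∧ ∃ k' : Fin 4, k' ≠ k ∧
        (∀ c', 1 ≤ c' → c' < c →
          Function.update Z σ (lpt c' k) ∉ C.upper ∧ Function.update Z σ (lpt c' k') ∉ C.upper) ∧
        Function.update Z σ (lpt c k') ∈ C.lower)

/-- X-PHASE IMMUNITY ⇒ X-CLEAN: if the `P`-letters lie in the cone of `O` (automatic in `𝒰`) and no `N`-cell satisfies typer-2's
kill predicate `XPhaseDeadMu4` (§22), the configuration is X-clean — by `xPhaseDeadMu4_of_ray`. -/
theorem xcleanMu4_of_immune {C : MConfig} (hcone : ∀ P ∈ C.upper, ∀ g, Effective (P g))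
    (himm : ∀ Z ∈ C.lower, ∀ σ k f, ¬ XPhaseDeadMu4 C Z σ k f) : XCleanMu4 C :=
  fun Z hZ f σ hσf hO k _ hc hZσ ⟨hq, _, hk', hmid, hn⟩ =>
    himm Z hZ σ k f (xPhaseDeadMu4_of_ray C hcone hσf hO hc hZσ hq hk' hmid hn)

/-- the cells attacked by LEMMA X∞-A (memo §2 `𝒩_c ∪ 𝒫_c`): an O-factor `f`, a pure ray on `σ`, a further charged factor. -/
abbrev MixedMu4 (Z : MCell) (f σ : Fin 4) : Prop :=
  Z f = (0, 0, 0) ∧ (∃ c : ℤ, 1 ≤ c ∧ ∃ k : Fin 4, Z σ = lpt c k) ∧ ∃ g, g ≠ f ∧ g ≠ σ ∧ Z g ≠ (0, 0, 0)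

/-- **the hypotheses of THEOREM X∞ on 𝔅(μ₄)** (memo (0.5) «ADMISSIBLE», all four phases): cells in `𝒰` on both levels,
RULE-D-closed in the sense of `Pad4TowerRuleDMu4` (PAD4-BALANCED §1′ ∕ memo (0.3)), PSC, X-clean. -/
structure AdmissibleMu4 (C : MConfig) : Prop where
  /-- `N`-letters in `𝒰` -/
  uN : ∀ Z ∈ C.lower, ∀ f, InUMu4 (Z f)
  /-- `P`-letters in `𝒰` -/
  uP : ∀ P ∈ C.upper, ∀ f, InUMu4 (P f)
  /-- RULE D on 𝔅(μ₄), both levels -/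
  ruleD : RuleDMu4Closed C
  /-- phase-sibling closure at O-carrying `N`-cells -/
  psc : PSCMu4 C
  /-- no `N`-cell meets the apex-vertex X-PHASE instance -/
  xclean : XCleanMu4 C

/-- fully charged: no O-factor. -/
abbrev FCMu4 (X : MCell) : Prop := ∀ f, X f ≠ (0, 0, 0)

end Summit.Ventures.HSemireg.Pad4Tower
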